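import Summits.AtomisticToContinuum.Crystallization.Theorems.ChargedEnergyGap.Negative.BlocksEnergy

/-!
# Blocks of a periodic configuration II: tails and lattice geometry

The Lennard-Jones tail of a block point is bounded below by `−1/6` of its inverse-sixth-power
tail; the latter is at most the full (translation-invariant) sixth-power site sum, and at most
its far part `Σ_{|q − x| ≥ ρ} |x − q|⁻⁶` (which tends to `0` as `ρ → ∞`) when the block point is
deep: lattice coordinates are bounded by `Λ·‖·‖` (`Λ` from the coordinate functionals of the real
basis), so a point all of whose coordinates are `ρ'`-away from the faces of `[0,K)³` is at
distance `≥ ρ` from every point outside the block once `ρ' ≥ Λ(ρ + 2D_F)`.  All `[folklore]`.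
-/

noncomputable section

namespace Summit.AtomisticToContinuum.Crystallization.Theorems.ChargedEnergyGapNegative

open Literature.MathematicalPhysics.StatisticalMechanics
open scoped BigOperators

namespace Blocks

variable (Q : PeriodicConfiguration 3)

variable (K : ℕ)

/-! ### Tails are controlled by inverse-sixth-power sums -/

/-- The inverse sixth power as a "potential". [folklore] -/
def six : ℝ → ℝ := fun r => r⁻¹ ^ 6

/-- `six ≥ 0`. [folklore] -/
theorem six_nonneg (r : ℝ) : 0 ≤ six r := by
  unfold six; positivity

/-- `V_LJ(r) ≥ −(1/6)·six r` for `r > 0`. [folklore] -/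
theorem neg_six_le_lennardJones {r : ℝ} (hr : 0 < r) : -(1 / 6 * six r) ≤ lennardJones r :=
  neg_le_lennardJones_of_le hr le_rfl

/-- The inverse-sixth-power lattice sum at `p` is summable (`d = 3 < 6`). [folklore] -/
theorem summable_six (p : E3) :
    Summable fun q : {q : E3 // q ∈ Q.points ∧ q ≠ p} => six (dist p q.1) :=
  Q.summable_inv_pow_six_dist (by norm_num) p

/-- The sixth-power tail over the complement of the block. [folklore] -/
def tailSix (u : BIdx Q K) : ℝ :=
  ∑' q : ((blockOthers Q K u : Set {q : E3 // q ∈ Q.points ∧ q ≠ bpt Q K u})ᶜ : Set _),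
    six (dist (bpt Q K u) q.1.1)

/-- `tailSix ≥ 0`. [folklore] -/
theorem tailSix_nonneg (u : BIdx Q K) : 0 ≤ tailSix Q K u :=
  tsum_nonneg fun _ => six_nonneg _

/-- **The Lennard-Jones tail is bounded below by the sixth-power tail**:
`tail u ≥ −(1/6)·tailSix u`. [folklore] -/
theorem neg_tailSix_le_tail (u : BIdx Q K) :
    -(1 / 6 * tailSix Q K u) ≤ tail Q K lennardJones u := by
  unfold tail tailSix
  rw [← tsum_mul_left, ← tsum_neg]
  refine Summable.tsum_le_tsum (fun q => neg_six_le_lennardJones (dist_pos.2 (Ne.symm q.1.2.2)))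
    ?_ ?_
  · exact (((summable_six Q (bpt Q K u)).subtype _).mul_left (1 / 6)).neg
  · exact (Q.summable_lennardJones_dist_three (bpt Q K u)).subtype _

/-- The sixth-power tail is at most the full sixth-power site sum at the block point.
[folklore] -/
theorem tailSix_le_siteSum_bpt (u : BIdx Q K) : tailSix Q K u ≤ siteSum Q six (bpt Q K u) := by
  unfold tailSix siteSum
  exact (summable_six Q (bpt Q K u)).tsum_subtype_le
    (fun q : {q : E3 // q ∈ Q.points ∧ q ≠ bpt Q K u} => six (dist (bpt Q K u) q.1))
    ((blockOthers Q K u : Set {q : E3 // q ∈ Q.points ∧ q ≠ bpt Q K u})ᶜ)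
    (fun _ => six_nonneg _)

/-- … which is translation invariant: `tailSix u ≤ siteSum six (u.1)`. [folklore] -/
theorem tailSix_le_siteSum (u : BIdx Q K) : tailSix Q K u ≤ siteSum Q six u.1 := by
  have := tailSix_le_siteSum_bpt Q K u
  rwa [siteSum_bpt Q K six u] at this

/-- The far part of the sixth-power site sum: terms at distance `≥ ρ`. [folklore] -/
def farSix (x : E3) (ρ : ℝ) : ℝ :=
  ∑' q : {q : {q : E3 // q ∈ Q.points ∧ q ≠ x} // ρ ≤ dist x q.1}, six (dist x q.1.1)

/-- Monotonicity of sub-sums of a non-negative summable family along an implication of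
predicates. [folklore] -/
theorem tsum_subtype_mono {β : Type*} {f : β → ℝ} (hf : Summable f) (h0 : ∀ b, 0 ≤ f b)
    {p p' : β → Prop} (hpp : ∀ b, p b → p' b) :
    ∑' b : {b // p b}, f b.1 ≤ ∑' b : {b // p' b}, f b.1 := by
  refine Summable.tsum_le_tsum_of_inj (fun b : {b // p b} => (⟨b.1, hpp b.1 b.2⟩ : {b // p' b}))
    (fun a b h => Subtype.ext (by simpa using congrArg Subtype.val h))
    (fun c _ => h0 c.1) (fun b => le_rfl) ?_ ?_
  · exact hf.subtype {b | p b}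
  · exact hf.subtype {b | p' b}

/-- Translating by a period permutes the far points. [folklore] -/
def farShiftEquiv {g : E3} (hg : g ∈ Q.lattice) (x : E3) (ρ : ℝ) :
    {q : {q : E3 // q ∈ Q.points ∧ q ≠ x} // ρ ≤ dist x q.1} ≃
      {q : {q : E3 // q ∈ Q.points ∧ q ≠ x + g} // ρ ≤ dist (x + g) q.1} where
  toFun q := ⟨shiftEquiv Q hg x q.1, by
    have := q.2; simpa [shiftEquiv, dist_add_right] using this⟩
  invFun q := ⟨(shiftEquiv Q hg x).symm q.1, by
    have h := q.2
    have e : ((shiftEquiv Q hg x).symm q.1).1 + g = q.1.1 := by simp [shiftEquiv]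
    rw [← e, dist_add_right] at h
    exact h⟩
  left_inv q := Subtype.ext (by simp)
  right_inv q := Subtype.ext (by simp)

/-- **Translation invariance of the far part.** [folklore] -/
theorem farSix_add {g : E3} (hg : g ∈ Q.lattice) (x : E3) (ρ : ℝ) :
    farSix Q (x + g) ρ = farSix Q x ρ := by
  unfold farSix
  rw [← Equiv.tsum_eq (farShiftEquiv Q hg x ρ)]
  congr 1
  funext q
  simp [farShiftEquiv, shiftEquiv, dist_add_right]

/-- If every point outside the block is at distance `≥ ρ` from the block point `u`, its
sixth-power tail is at most the far part at `u`'s own motif point. [folklore] -/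
theorem tailSix_le_farSix (u : BIdx Q K) {ρ : ℝ}
    (hfar : ∀ q : {q : E3 // q ∈ Q.points ∧ q ≠ bpt Q K u}, q ∉ blockOthers Q K u →
      ρ ≤ dist (bpt Q K u) q.1) :
    tailSix Q K u ≤ farSix Q u.1 ρ := by
  have h1 : tailSix Q K u ≤ farSix Q (bpt Q K u) ρ := by
    unfold tailSix farSix
    exact tsum_subtype_mono (summable_six Q (bpt Q K u)) (fun _ => six_nonneg _)
      (fun q hq => hfar q (by simpa using hq))
  have h2 : farSix Q (bpt Q K u) ρ = farSix Q u.1 ρ := farSix_add Q (latVec_mem Q (coords K u.2)) _ ρ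
  rw [← h2]; exact h1

/-- **The far part tends to zero**: for every `ε > 0` there is `ρ₀` beyond which
`farSix x ρ < ε` (summability). [folklore] -/
theorem exists_farSix_lt (x : E3) {ε : ℝ} (hε : 0 < ε) :
    ∃ ρ₀ : ℝ, ∀ ρ, ρ₀ ≤ ρ → farSix Q x ρ < ε := by
  -- tails over complements of finite sets tend to zero
  have ht : Filter.Tendsto (fun s : Finset {q : E3 // q ∈ Q.points ∧ q ≠ x} =>
      ∑' q : {q : {q : E3 // q ∈ Q.points ∧ q ≠ x} // q ∉ s}, six (dist x q.1.1))
      Filter.atTop (nhds 0) :=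
    tendsto_tsum_compl_atTop_zero (fun q : {q : E3 // q ∈ Q.points ∧ q ≠ x} => six (dist x q.1))
  have hev : ∀ᶠ s : Finset {q : E3 // q ∈ Q.points ∧ q ≠ x} in Filter.atTop,
      ∑' q : {q : {q : E3 // q ∈ Q.points ∧ q ≠ x} // q ∉ s}, six (dist x q.1.1) < ε :=
    ht.eventually (gt_mem_nhds hε)
  obtain ⟨s₀, hs₀⟩ := Filter.eventually_atTop.1 hev
  have hs₀' : ∑' q : {q : {q : E3 // q ∈ Q.points ∧ q ≠ x} // q ∉ s₀}, six (dist x q.1.1) < ε :=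
    hs₀ s₀ le_rfl
  refine ⟨(∑ q' ∈ s₀, dist x q'.1) + 1, fun ρ hρ => ?_⟩
  have h1 : (∑ q' ∈ s₀, dist x q'.1) < ρ := lt_of_lt_of_le (lt_add_one _) hρ
  have hsub : ∀ q : {q : E3 // q ∈ Q.points ∧ q ≠ x}, ρ ≤ dist x q.1 → q ∉ s₀ := by
    intro q hq hqs
    have h2 := Finset.single_le_sum (s := s₀) (f := fun q' => dist x q'.1)
      (fun _ _ => dist_nonneg) hqs
    exact absurd (hq.trans h2) (not_le.2 h1)
  have hmono : farSix Q x ρ ≤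
      ∑' q : {q : {q : E3 // q ∈ Q.points ∧ q ≠ x} // q ∉ s₀}, six (dist x q.1.1) :=
    tsum_subtype_mono (summable_six Q x) (fun _ => six_nonneg _) hsub
  exact hmono.trans_lt hs₀'


/-! ### Lattice coordinates control distances -/

/-- The real basis of `ℝ³` underlying the `ℤ`-basis of the lattice. [folklore] -/
def rBasis : Module.Basis (Fin 3) ℝ E3 := (zBasis Q).ofZLatticeBasis ℝ Q.lattice

/-- Coordinates of lattice vectors are their integer coordinates. [folklore] -/
theorem rBasis_repr_latVec (c : Fin 3 → ℤ) (i : Fin 3) :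
    (rBasis Q).repr (latVec Q c) i = c i := by
  unfold rBasis latVec
  rw [Module.Basis.ofZLatticeBasis_repr_apply]
  unfold latVecL
  rw [← Module.Basis.equivFun_apply, LinearEquiv.apply_symm_apply]

/-- A bound for the coordinate functionals: `Λ = Σᵢ ‖coordᵢ‖`. [folklore] -/
def coordBound : ℝ := ∑ i, ‖LinearMap.toContinuousLinearMap ((rBasis Q).coord i)‖

/-- `0 ≤ Λ`. [folklore] -/
theorem coordBound_nonneg : 0 ≤ coordBound Q := Finset.sum_nonneg fun _ _ => norm_nonneg _

/-- **Coordinates are bounded by the norm**: `|coordᵢ(v)| ≤ Λ‖v‖`. [folklore] -/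
theorem abs_repr_le (v : E3) (i : Fin 3) : |(rBasis Q).repr v i| ≤ coordBound Q * ‖v‖ := by
  have h1 : |(rBasis Q).repr v i| ≤
      ‖LinearMap.toContinuousLinearMap ((rBasis Q).coord i)‖ * ‖v‖ := by
    have := (LinearMap.toContinuousLinearMap ((rBasis Q).coord i)).le_opNorm v
    simpa [Module.Basis.coord_apply, Real.norm_eq_abs] using this
  have h2 := Finset.single_le_sum (s := Finset.univ)
    (f := fun i => ‖LinearMap.toContinuousLinearMap ((rBasis Q).coord i)‖)
    (fun _ _ => norm_nonneg _) (Finset.mem_univ i)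
  have h3 : ‖LinearMap.toContinuousLinearMap ((rBasis Q).coord i)‖ * ‖v‖ ≤ coordBound Q * ‖v‖ :=
    mul_le_mul_of_nonneg_right h2 (norm_nonneg v)
  exact h1.trans h3

/-- Hence `|cᵢ| ≤ Λ‖latVec c‖` for integer coordinates. [folklore] -/
theorem abs_le_coordBound_mul_norm_latVec (c : Fin 3 → ℤ) (i : Fin 3) :
    |(c i : ℝ)| ≤ coordBound Q * ‖latVec Q c‖ := by
  have := abs_repr_le Q (latVec Q c) i
  rwa [rBasis_repr_latVec] at this

/-- A size bound of the motif: `D_F = Σ_{x ∈ F} ‖x‖`. [folklore] -/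
def motifSize : ℝ := ∑ x ∈ Q.motif, ‖x‖

/-- `0 ≤ D_F`. [folklore] -/
theorem motifSize_nonneg : 0 ≤ motifSize Q := Finset.sum_nonneg fun _ _ => norm_nonneg _

/-- `‖x‖ ≤ D_F` for motif points. [folklore] -/
theorem norm_le_motifSize {x : E3} (hx : x ∈ Q.motif) : ‖x‖ ≤ motifSize Q := by
  have := Finset.single_le_sum (s := Q.motif) (f := fun x : E3 => ‖x‖) (fun _ _ => norm_nonneg _) hx
  exact this

/-- Motif points are within `2D_F` of each other. [folklore] -/
theorem norm_sub_le_two_motifSize {x x' : E3} (hx : x ∈ Q.motif) (hx' : x' ∈ Q.motif) :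
    ‖x - x'‖ ≤ 2 * motifSize Q :=
  (norm_sub_le _ _).trans (by linarith [norm_le_motifSize Q hx, norm_le_motifSize Q hx'])

/-- **Deep** lattice coordinates: at least `ρ'` away from the faces of `[0, K)³`. [folklore] -/
def IsDeep (ρ' : ℕ) (k : Fin 3 → Fin K) : Prop := ∀ i, ρ' ≤ (k i : ℕ) ∧ (k i : ℕ) + ρ' < K

/-- Deepness is decidable. [folklore] -/
instance instDecidableIsDeep (ρ' : ℕ) (k : Fin 3 → Fin K) : Decidable (IsDeep K ρ' k) := by
  unfold IsDeep; infer_instance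

/-- A point of `Q` all of whose lattice coordinates (relative to some motif point) lie in
`[0, K)` is a block point. [folklore] -/
theorem exists_bpt_eq {x' : E3} (hx' : x' ∈ Q.motif) {m : Fin 3 → ℤ}
    (hm : ∀ i, 0 ≤ m i ∧ m i < K) : ∃ v : BIdx Q K, bpt Q K v = x' + latVec Q m := by
  refine ⟨(⟨x', hx'⟩, fun i => ⟨(m i).toNat, ?_⟩), ?_⟩
  · have := (hm i).2; have := (hm i).1; omega
  · simp only [bpt]
    congr 1
    congr 1
    funext i
    simp only [coords]
    exact Int.toNat_of_nonneg (hm i).1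

/-- **Deep block points are far from the outside**: if `u = (x, k)` is `ρ'`-deep then every
point of `Q` outside the block satisfies `ρ' + 1 ≤ Λ·(dist(u, q) + 2D_F)`. [folklore] -/
theorem deep_far {ρ' : ℕ} {u : BIdx Q K} (hdeep : IsDeep K ρ' u.2)
    (q : {q : E3 // q ∈ Q.points ∧ q ≠ bpt Q K u}) (hq : q ∉ blockOthers Q K u) :
    (ρ' : ℝ) + 1 ≤ coordBound Q * (dist (bpt Q K u) q.1 + 2 * motifSize Q) := by
  obtain ⟨x', hx', g', hg', hqe⟩ := q.2.1
  obtain ⟨m, rfl⟩ := exists_latVec_eq Q hg'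
  -- some coordinate of `m` is outside `[0, K)`
  have hout : ∃ i, m i < 0 ∨ (K : ℤ) ≤ m i := by
    by_contra hall
    push Not at hall
    obtain ⟨v, hv⟩ := exists_bpt_eq Q K hx' (m := m) fun i => ⟨(hall i).1, (hall i).2⟩
    rw [← hqe] at hv
    by_cases hvu : v = u
    · exact q.2.2 (by rw [← hv, hvu])
    · exact hq (Finset.mem_image.2 ⟨⟨v, Finset.mem_erase.2 ⟨hvu, Finset.mem_univ v⟩⟩,
        Finset.mem_attach _ _, Subtype.ext hv⟩)
  obtain ⟨i, hi⟩ := hout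
  -- the integer coordinate difference at `i` is at least `ρ' + 1`
  have hk1 := (hdeep i).1
  have hk2 := (hdeep i).2
  have hdiff : (ρ' : ℝ) + 1 ≤ |((coords K u.2 i - m i : ℤ) : ℝ)| := by
    rw [← Int.cast_abs]
    have : (ρ' : ℤ) + 1 ≤ |coords K u.2 i - m i| := by
      simp only [coords]
      rcases hi with hi | hi
      · rw [abs_of_nonneg (by omega)]; omega
      · rw [abs_of_nonpos (by omega)]; omega
    exact_mod_cast this
  -- and it is controlled by the norm of the lattice vector, hence by the distance
  have hlat := abs_le_coordBound_mul_norm_latVec Q (coords K u.2 - m) i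
  simp only [Pi.sub_apply] at hlat
  have hvec : latVec Q (coords K u.2 - m) = (bpt Q K u - q.1) + (x' - u.1) := by
    rw [latVec_sub, hqe]; simp only [bpt]; abel
  have hnorm : ‖latVec Q (coords K u.2 - m)‖ ≤ dist (bpt Q K u) q.1 + 2 * motifSize Q := by
    rw [hvec, dist_eq_norm]
    exact (norm_add_le _ _).trans (add_le_add le_rfl (norm_sub_le_two_motifSize Q hx' u.1.2))
  have hΛ := coordBound_nonneg Q
  calc (ρ' : ℝ) + 1 ≤ |((coords K u.2 i - m i : ℤ) : ℝ)| := hdiff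
    _ = |((coords K u.2 i : ℝ)) - (m i : ℝ)| := by push_cast; ring_nf
    _ ≤ coordBound Q * ‖latVec Q (coords K u.2 - m)‖ := by
        have := hlat; push_cast at this; exact this
    _ ≤ coordBound Q * (dist (bpt Q K u) q.1 + 2 * motifSize Q) :=
        mul_le_mul_of_nonneg_left hnorm hΛ

/-- The depth needed for a given clearance `ρ`: `ρ'(ρ) = ⌈Λ(ρ + 2D_F)⌉₊`. [folklore] -/
def depth (ρ : ℝ) : ℕ := ⌈coordBound Q * (ρ + 2 * motifSize Q)⌉₊

/-- **Deep points have clearance `ρ`**: every point of `Q` outside the block is at distance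
`≥ ρ` from a `ρ'(ρ)`-deep block point. [folklore] -/
theorem le_dist_of_deep {ρ : ℝ} {u : BIdx Q K} (hdeep : IsDeep K (depth Q ρ) u.2)
    (q : {q : E3 // q ∈ Q.points ∧ q ≠ bpt Q K u}) (hq : q ∉ blockOthers Q K u) :
    ρ ≤ dist (bpt Q K u) q.1 := by
  have h := deep_far Q K hdeep q hq
  have hceil : coordBound Q * (ρ + 2 * motifSize Q) ≤ (depth Q ρ : ℝ) := Nat.le_ceil _
  have hΛ := coordBound_nonneg Q
  rcases hΛ.eq_or_lt with hΛ0 | hΛpos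
  · rw [← hΛ0] at h; simp at h; linarith
  · by_contra hlt
    push Not at hlt
    have : coordBound Q * (dist (bpt Q K u) q.1 + 2 * motifSize Q) <
        coordBound Q * (ρ + 2 * motifSize Q) := mul_lt_mul_of_pos_left (by linarith) hΛpos
    linarith


end Blocks

end Summit.AtomisticToContinuum.Crystallization.Theorems.ChargedEnergyGapNegative

end
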